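import Summits.BirchSwinnertonDyer.Rank1Residual.X5.TwoAdicImageCriteriaLift
import Literature.NumberTheory.EllipticCurves.MazurTorsionGaloisStructureProofs
import HarnessLib

/-!
# Class O1 (X5, `p = 2`): the atom `RationalTwoTorsion W` (`= Red W 2`) IS "a rational point of
# order `2`" — kernel theorem, both directions

HONEST FRAMING (cell `b2b-bsdres`, run/shared/lean/b2b/bsd-rank1-residual/, verbatim in every
file): the goal of the cell is to DELETE the COMBINATION-SHAPED residual classes of the
Birch–Swinnerton-Dyer formula for ALL analytic-rank `≤ 1` elliptic curves over `ℚ` — "full BSD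
formula for every rank `≤ 1` curve in class `C`" assembled STRICTLY from published theorems — so
that the rank-`≤ 1` remainder becomes exactly the CONSTRUCTION-SHAPED classes, which are TYPED
(missing-input `Prop`s), NOT attempted. This is not "finishing BSD". Research routes; no claim
beyond stated classes; nothing here is booked; no mark of RESIDUAL-MAP §I moves; O1 stays OPEN.

Harvest seat 1 (`b2b-bsdres-harvest-1`, split `p = 2` / CM / supersingular), gen 28. Theorems only
(no definition, no named fact). `X5/TwoAdicTargets.lean` defines the small-image atom at `2` as
`RationalTwoTorsion W := Red W 2` (`E[2]` a reducible `Γ_ℚ`-module) with the docstring gloss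
"`E` has a rational point of order `2` (⟺ `E[2]` reducible ⟺ image of `ρ̄_{E,2}` in
`GL₂(𝔽₂) ≅ S₃` of order `≤ 2`)". This file proves the gloss in the kernel, so that the atom is
decided per curve by exhibiting or excluding a rational root of the `2`-division cubic (the
Dokchitser–Dokchitser hypothesis "no rational point of exact order `2`" of
`X5/TwoAdicImageCriteria.lean` is then literally `Irr W 2`):

* `exists_addOrderOf_eq_two_of_red_two` — `Red W 2 → ∃ P : E(ℚ), addOrderOf P = 2`: a proper
  non-zero `Γ_ℚ`-stable subgroup of `E[2]` (order `4`, `natCard_geomTorsion`) has order `2`, its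
  non-zero element is `Γ_ℚ`-fixed, hence rational (Galois descent,
  `exists_toGeomPoints_eq_of_forall_smul_eq`);
* `red_two_of_addOrderOf_eq_two` — the converse (Mazur's Borel shape at `N = 2`, tree
  `not_hasIrreducibleModPGaloisRep_of_addOrderOf_eq`);
* `rationalTwoTorsion_iff`, `irr_two_iff_not_exists_addOrderOf_eq_two`,
  `irr_two_iff_forall_two_nsmul` — the atom in both currencies (`addOrderOf P = 2`;
  `2 • P = 0 → P = 0`, the hypothesis `h2` of `twoAdicSurjective_of_dokchitser`);
* `twoAdicSurjective_of_dokchitser_of_irr` — the Dokchitser–Dokchitser discharge of the habitat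
  binder `TwoAdicSurjective W` with `h2` replaced by the cell atom `Irr W 2` (one named fact left:
  `DokchitserDokchitser2012_surjective_mod_two_four_eight`; the mod-`8` lift is the tree theorem
  `hasSurjectiveModNGaloisRep_two_pow_of_eight_holds`, file `X5/TwoAdicImageCriteriaLift.lean`).

References: Silverman, *AEC* III.§7 (Galois action on `E[m]`), VIII.§1 (descent of fixed points);
Mazur 1977 Ch. III §5 p. 157 (the Borel shape of a rational `N`-torsion point).
-/

set_option autoImplicit false

noncomputable section

open scoped Classical

open WeierstrassCurve Literature.NumberTheory.EllipticCurves
  Literature.NumberTheory.EllipticCurves.Rank1Residual Field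

namespace Summit.BirchSwinnertonDyer.Rank1Residual.X5.O1

variable (W : WeierstrassCurve ℚ) [W.IsElliptic]

/-- **A reducible `E[2]` carries a rational point of order `2`.** If `E[2]` has a `Γ_ℚ`-stable
subgroup `H ≠ 0, E[2]`, then `#H = 2` (`#E[2] = 4`), the non-zero element `Q` of `H` is fixed by
every `σ ∈ Γ_ℚ` (`σQ ∈ H ∖ 0 = {Q}`), so `Q ∈ E(ℚ)` by Galois descent, of order `2`. [folklore] -/
theorem exists_addOrderOf_eq_two_of_red_two (h : Red W 2) :
    ∃ P : W.toAffine.Point, addOrderOf P = 2 := by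
  haveI : NeZero ((2 : ℕ) : ℚ) := ⟨by norm_num⟩
  have hred : ¬ W.HasIrreducibleModPGaloisRep 2 := h
  unfold WeierstrassCurve.HasIrreducibleModPGaloisRep at hred
  push Not at hred
  obtain ⟨H, hstab, hbot, htop⟩ := hred
  have hcard : Nat.card (geomTorsion W ((2 : ℕ) : ℤ)) = 2 ^ 2 :=
    Literature.NumberTheory.EllipticCurves.natCard_geomTorsion W 2
  haveI : Finite (geomTorsion W ((2 : ℕ) : ℤ)) :=
    Nat.finite_of_card_ne_zero (by rw [hcard]; norm_num)
  -- `#H = 2`: `#H ∣ 4`, `#H ≠ 1` (`H ≠ ⊥`), `#H ≠ 4` (`H ≠ ⊤`)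
  have hH1 : Nat.card H ≠ 1 := fun h1 ↦ hbot (AddSubgroup.card_eq_one.mp h1)
  have hH4 : Nat.card H ≠ 4 := fun h4 ↦
    htop (AddSubgroup.eq_top_of_card_eq H (by rw [h4, hcard]; norm_num))
  have hdvd : Nat.card H ∣ 2 ^ 2 := hcard ▸ AddSubgroup.card_addSubgroup_dvd_card H
  obtain ⟨i, hi, hHi⟩ := (Nat.dvd_prime_pow Nat.prime_two).mp hdvd
  have hH2 : Nat.card H = 2 := by
    interval_cases i
    · exact absurd (by simpa using hHi) hH1
    · simpa using hHi
    · exact absurd (by simpa using hHi) hH4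
  -- the non-zero element `Q` of `H` is fixed by `Γ_ℚ` (`σ • Q ∈ H ∖ {0} = {Q}`)
  obtain ⟨Q, hQ0, hQuniq⟩ := (Nat.card_eq_two_iff' (0 : H)).mp hH2
  have hQne : (Q.1 : geomTorsion W ((2 : ℕ) : ℤ)) ≠ 0 := fun h0 ↦ hQ0 (Subtype.ext h0)
  have hfix : ∀ σ : absoluteGaloisGroup ℚ, σ • (Q.1 : geomTorsion W ((2 : ℕ) : ℤ)) = Q.1 := by
    intro σ
    have hmem : σ • (Q.1 : geomTorsion W ((2 : ℕ) : ℤ)) ∈ H := hstab σ Q.1 Q.2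
    have hne : (⟨σ • (Q.1 : geomTorsion W ((2 : ℕ) : ℤ)), hmem⟩ : H) ≠ 0 := by
      intro h0
      have h1 : σ • (Q.1 : geomTorsion W ((2 : ℕ) : ℤ)) = 0 := congrArg Subtype.val h0
      rw [smul_eq_zero_iff_eq] at h1
      exact hQne h1
    exact congrArg Subtype.val (hQuniq _ hne)
  -- Galois descent: `Q` comes from a rational point `P`
  have hfix' : ∀ σ : absoluteGaloisGroup ℚ,
      σ • ((Q.1 : geomTorsion W ((2 : ℕ) : ℤ)) : geomPoints W) =
        ((Q.1 : geomTorsion W ((2 : ℕ) : ℤ)) : geomPoints W) := fun σ ↦ by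
    rw [← AddSubgroup.torsionBy.coe_smul, hfix σ]
  obtain ⟨P, hP⟩ := exists_toGeomPoints_eq_of_forall_smul_eq W hfix'
  -- `addOrderOf P = addOrderOf Q = 2` (`E(ℚ) ↪ E(ℚ̄)` injective); the last step moves between the
  -- two `DecidableEq ℚ` instances of Mathlib's group law (`addOrderOf_point_eq_of_subsingleton`)
  have hordQ : addOrderOf (Q.1 : geomTorsion W ((2 : ℕ) : ℤ)) = 2 :=
    addOrderOf_eq_of_ne_zero W 2 hQne
  have hPc := @addOrderOf_injective W.toAffine.Point
    (@SubNegMonoid.toAddMonoid _ (@AddGroup.toSubNegMonoid _ (@AddCommGroup.toAddGroup _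
      (@WeierstrassCurve.Affine.Point.instAddCommGroup ℚ _ W.toAffine
        (fun a b => Classical.propDecidable (a = b)))))) (geomPoints W) _
    (toGeomPoints W) (toGeomPoints_injective W) P
  rw [hP, AddSubgroup.addOrderOf_coe, hordQ] at hPc
  exact ⟨P, (addOrderOf_point_eq_of_subsingleton W _ _ _).trans hPc.symm⟩

/-- **A rational point of order `2` makes `E[2]` reducible** (`Red W 2`): the line it spans is
`Γ_ℚ`-stable (Mazur's Borel shape at `N = 2`, tree
`not_hasIrreducibleModPGaloisRep_of_addOrderOf_eq`). [folklore] -/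
theorem red_two_of_addOrderOf_eq_two {P : W.toAffine.Point} (hP : addOrderOf P = 2) : Red W 2 :=
  not_hasIrreducibleModPGaloisRep_of_addOrderOf_eq W hP

/-- **The atom `RationalTwoTorsion W` (`= Red W 2`) is literally "`E(ℚ)` has a point of order
`2`".** [folklore] -/
theorem rationalTwoTorsion_iff :
    RationalTwoTorsion W ↔ ∃ P : W.toAffine.Point, addOrderOf P = 2 :=
  ⟨exists_addOrderOf_eq_two_of_red_two W, fun ⟨_, hP⟩ ↦ red_two_of_addOrderOf_eq_two W hP⟩

/-- **`Irr W 2` ⟺ no rational point of order `2`.** [folklore] -/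
theorem irr_two_iff_not_exists_addOrderOf_eq_two :
    Irr W 2 ↔ ¬ ∃ P : W.toAffine.Point, addOrderOf P = 2 := by
  rw [← rationalTwoTorsion_iff]
  unfold RationalTwoTorsion Red Irr
  rw [not_not]

/-- **`Irr W 2` ⟺ `2 • P = 0 → P = 0` on `E(ℚ)`** — the hypothesis "no rational point of exact
order `2`" of the Dokchitser–Dokchitser criterion (`twoAdicSurjective_of_dokchitser`, `h2`) in the
cell's image currency. [folklore] -/
theorem irr_two_iff_forall_two_nsmul :
    Irr W 2 ↔ ∀ P : W.toAffine.Point, 2 • P = 0 → P = 0 := by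
  rw [irr_two_iff_not_exists_addOrderOf_eq_two]
  constructor
  · intro h P h2P
    by_contra hP0
    exact h ⟨P, addOrderOf_eq_prime h2P hP0⟩
  · rintro h ⟨P, hP⟩
    have h2P : 2 • P = 0 := by rw [← hP]; exact addOrderOf_nsmul_eq_zero P
    have hP0 := h P h2P
    rw [hP0, addOrderOf_zero] at hP
    exact absurd hP (by norm_num)

/-- **The habitat binder from PRINT in the cell's image currency** (PROVED modulo the one named
fact `DokchitserDokchitser2012_surjective_mod_two_four_eight`): `Irr W 2`, `Δ, −Δ, 2Δ, −2Δ ∉ ℚ^{×2}`,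
`j ≠ −4t³(t + 8)` for all `t ∈ ℚ` ⟹ `TwoAdicSurjective W`.
[cite: DokchitserDokchitserMathZ2012, Theorem (p. 961)] [cite: RouseZureickbrown2015, §3 Lemma and §1] -/
theorem twoAdicSurjective_of_dokchitser_of_irr
    (hDD : DokchitserDokchitser2012_surjective_mod_two_four_eight) (hirr : Irr W 2)
    (hΔ : ¬ IsSquare W.Δ) (hΔ₁ : ¬ IsSquare (-W.Δ)) (hΔ₂ : ¬ IsSquare (2 * W.Δ))
    (hΔ₃ : ¬ IsSquare (-2 * W.Δ)) (hj : ∀ t : ℚ, W.j ≠ -4 * t ^ 3 * (t + 8)) :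
    TwoAdicSurjective W :=
  twoAdicSurjective_of_dokchitser' W hDD ((irr_two_iff_forall_two_nsmul W).mp hirr) hΔ hΔ₁ hΔ₂ hΔ₃ hj

end Summit.BirchSwinnertonDyer.Rank1Residual.X5.O1

end
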